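import Mathlib
import Literature.AlgebraicGeometry.HyperbolicPolynomials.HyperbolicityCone
import HarnessLib

/-!
# Low-order coefficients of the line polynomial `t ↦ f(x + tv)`

Topic `Literature/AlgebraicGeometry/HyperbolicPolynomials`. `HyperbolicityCone.lean` defines
`linePoly f x v ∈ R[t]`, the restriction `t ↦ f(x + tv)` of `f ∈ R[X_σ]`. This file records the
dictionary between its low-order coefficients and the differential calculus of `f` (all PROVED):

* `coeff_zero_linePoly` — `coeff 0 = f(x)`;
* `coeff_one_linePoly` — `coeff 1 = Σⱼ vⱼ ∂ⱼ f(x) = ⟨∇f(x), v⟩` (`coeff_one_linePoly_single`: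
  `∂ⱼ f(x)` for `v = eⱼ`);
* `derivative_linePoly` — chain rule `d/dt f(x + tv) = (Σⱼ vⱼ∂ⱼf)(x + tv)`;
* `two_mul_coeff_two_linePoly` — `2 coeff 2 = Σᵢⱼ vᵢvⱼ ∂ᵢ∂ⱼ f(x) = vᵀ ∇²f(x) v`;
* `linePoly_mul_X`, `linePoly_neg`, `linePoly_zero_dir`.

These are the translations used to state strict quasi-concavity (Helton–Nie; Netzer–Sanyal §2:
"`g` is strictly quasi-concave at `a` if for every `v ≠ 0` with `g₁(v) = 0` we have `g₂(v) < 0`",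
where `g(x + a) = g₀ + g₁(x) + g₂(x) + ⋯`) coefficientwise. [folklore]
-/

noncomputable section

open MvPolynomial
open scoped BigOperators Polynomial

namespace Literature.AlgebraicGeometry.HyperbolicPolynomials

variable {σ : Type*}

/-! ### Low-order coefficients of the line polynomial -/

section LineCoeff

variable {R : Type*} [CommRing R]

/-- The constant coefficient of `t ↦ f(x + tv)` is `f(x)`. [folklore] -/
theorem coeff_zero_linePoly (f : MvPolynomial σ R) (x v : σ → R) :
    (linePoly f x v).coeff 0 = MvPolynomial.eval x f := by
  rw [Polynomial.coeff_zero_eq_eval_zero, eval_linePoly]; simp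

/-- `linePoly` of a product with a variable. [folklore] -/
theorem linePoly_mul_X (p : MvPolynomial σ R) (j : σ) (x v : σ → R) :
    linePoly (p * X j) x v =
      linePoly p x v * (Polynomial.C (v j) * Polynomial.X + Polynomial.C (x j)) := by
  simp [linePoly]

/-- **The linear coefficient of `t ↦ f(x + tv)` is the directional derivative `Σⱼ vⱼ ∂ⱼf(x)`.**
[folklore] -/
theorem coeff_one_linePoly [Fintype σ] (f : MvPolynomial σ R) (x v : σ → R) :
    (linePoly f x v).coeff 1 = ∑ j, v j * MvPolynomial.eval x (pderiv j f) := by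
  classical
  induction f using MvPolynomial.induction_on with
  | C a => simp [linePoly]
  | add p q hp hq =>
      simp only [linePoly, map_add, Polynomial.coeff_add] at hp hq ⊢
      rw [hp, hq, ← Finset.sum_add_distrib]
      exact Finset.sum_congr rfl fun j _ => by ring
  | mul_X p j hp =>
      rw [linePoly_mul_X, mul_add, Polynomial.coeff_add, ← mul_assoc, Polynomial.coeff_mul_X,
        Polynomial.coeff_mul_C, Polynomial.coeff_mul_C, hp, coeff_zero_linePoly]
      have hL : ∀ i, MvPolynomial.eval x (pderiv i (p * X j)) =
          MvPolynomial.eval x (pderiv i p) * x j +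
            MvPolynomial.eval x p * (if j = i then 1 else 0) := by
        intro i
        rw [pderiv_mul, map_add, map_mul, map_mul, MvPolynomial.eval_X, pderiv_X]
        by_cases hji : j = i
        · subst hji; simp
        · simp [hji]
      have hR : ∑ i, v i * MvPolynomial.eval x (pderiv i (p * X j)) =
          (∑ i, v i * MvPolynomial.eval x (pderiv i p)) * x j + MvPolynomial.eval x p * v j := by
        simp only [hL, mul_add, Finset.sum_add_distrib, Finset.sum_mul, mul_ite, mul_one, mul_zero,
          Finset.sum_ite_eq, Finset.mem_univ, if_true]
        congr 1
        · exact Finset.sum_congr rfl fun i _ => by ring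
        · ring
      rw [hR]
      ring

/-- `linePoly` of `-f`. [folklore] -/
theorem linePoly_neg (f : MvPolynomial σ R) (x v : σ → R) : linePoly (-f) x v = -linePoly f x v := by
  simp [linePoly]

/-- The line polynomial in direction `0` is the constant `f(x)`. [folklore] -/
theorem linePoly_zero_dir (f : MvPolynomial σ R) (x : σ → R) :
    linePoly f x 0 = Polynomial.C (MvPolynomial.eval x f) := by
  induction f using MvPolynomial.induction_on with
  | C a => simp [linePoly]
  | add p q hp hq =>
      simp only [linePoly, map_add] at hp hq ⊢
      rw [hp, hq]
  | mul_X p j hp =>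
      rw [linePoly_mul_X, hp]
      simp

/-- With a generic coefficient: `coeff 1 (linePoly f x (Pi.single j 1)) = ∂ⱼ f (x)`. [folklore] -/
theorem coeff_one_linePoly_single [Fintype σ] [DecidableEq σ] (f : MvPolynomial σ R) (x : σ → R)
    (j : σ) : (linePoly f x (Pi.single j 1)).coeff 1 = MvPolynomial.eval x (pderiv j f) := by
  rw [coeff_one_linePoly]
  simp [Pi.single_apply, Finset.sum_ite_eq', Finset.mem_univ]

/-- The directional derivative `Σⱼ vⱼ ∂ⱼ f` as a polynomial. [folklore] -/
theorem linePoly_sum_smul_pderiv_mul_X [Fintype σ] [DecidableEq σ] (p : MvPolynomial σ R) (j : σ)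
    (v : σ → R) :
    (∑ k, v k • pderiv k (p * X j)) = (∑ k, v k • pderiv k p) * X j + v j • p := by
  simp only [pderiv_mul, smul_add, Finset.sum_add_distrib, Finset.sum_mul, smul_mul_assoc]
  congr 1
  rw [Finset.sum_eq_single j (fun k _ hkj => by rw [pderiv_X, Pi.single_eq_of_ne' hkj, mul_zero,
    smul_zero]) (by simp)]
  rw [pderiv_X, Pi.single_eq_same, mul_one]

/-- **Chain rule along a line**: `d/dt f(x + tv) = (Σⱼ vⱼ ∂ⱼ f)(x + tv)` as polynomials in `t`.
[folklore] -/
theorem derivative_linePoly [Fintype σ] (f : MvPolynomial σ R) (x v : σ → R) :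
    Polynomial.derivative (linePoly f x v) = linePoly (∑ k, v k • pderiv k f) x v := by
  classical
  induction f using MvPolynomial.induction_on with
  | C a => simp [linePoly]
  | add p q hp hq =>
      simp only [linePoly, map_add, smul_add, Finset.sum_add_distrib] at hp hq ⊢
      rw [hp, hq]
  | mul_X p j hp =>
      have hd : Polynomial.derivative (Polynomial.C (v j) * Polynomial.X + Polynomial.C (x j)) =
          Polynomial.C (v j) := by simp
      rw [linePoly_mul_X, Polynomial.derivative_mul, hp, hd, linePoly_sum_smul_pderiv_mul_X]
      simp only [linePoly, map_add, map_mul, MvPolynomial.aeval_X, MvPolynomial.smul_eq_C_mul,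
        MvPolynomial.aeval_C, Polynomial.algebraMap_eq]
      ring

/-- **The quadratic coefficient of `t ↦ f(x + tv)` is half the Hessian quadratic form**:
`2 · coeff 2 = Σᵢⱼ vᵢ vⱼ ∂ᵢ∂ⱼ f(x)`. [folklore] -/
theorem two_mul_coeff_two_linePoly [Fintype σ] (f : MvPolynomial σ R) (x v : σ → R) :
    2 * (linePoly f x v).coeff 2 =
      ∑ i, ∑ j, v i * v j * MvPolynomial.eval x (pderiv i (pderiv j f)) := by
  classical
  have h1 : (Polynomial.derivative (linePoly f x v)).coeff 1 = (linePoly f x v).coeff 2 * 2 := by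
    rw [Polynomial.coeff_derivative]; norm_num
  rw [mul_comm, ← h1, derivative_linePoly, coeff_one_linePoly]
  refine Finset.sum_congr rfl fun i _ => ?_
  rw [map_sum, map_sum, Finset.mul_sum]
  refine Finset.sum_congr rfl fun j _ => ?_
  rw [MvPolynomial.smul_eq_C_mul, pderiv_C_mul, map_mul, MvPolynomial.eval_C]
  ring

end LineCoeff


end Literature.AlgebraicGeometry.HyperbolicPolynomials
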